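import Summits.ResolutionOfSingularities.ResolutionOfSingularities.Theses.WeightedInvariant
import Summits.ResolutionOfSingularities.ResolutionOfSingularities.Theorems.WeightedInvariantTerminatingCentreDatumConsumer
import HarnessLib

/-!
# Door implications for the re-typed door `HypersurfaceCentreConstruction` (route `WeightedInvariant`)

Topic: `Summits/ResolutionOfSingularities/ResolutionOfSingularities/Theorems`.  Route
`ResolutionOfSingularities/WeightedInvariant` after the door re-typing (director-resolution 2026-08-27,
planner `res-wc-repair-plan-1`): the OLD door `WeightedConstruction` (stmt-0571), and hence the route's
local engine `LocalWeightedDrop` (stmt-8899) together with its globalization glue `GlobalizeLocalDrop`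
(stmt-14763), imply the NEW door; the new consumer implies the old derived support `DatumToResolution`
(stmt-8974).  Lands `--supports <item id of HypersurfaceCentreConstruction>` AFTER (1) the def-module
`…Theorems.WeightedInvariantTerminatingCentreDatum`, (2) the route edit adding the two items, and (5) the
consumer module `…Theorems.WeightedInvariantTerminatingCentreDatumConsumer` have landed (TURNKEY.md /
ADDENDUM-g2.md).  Texts = RepairSketch(G2).lean Part C §(1) / Part D, farm rc 0 there.  Nothing here is a
claim about Hironaka's problem.  [OURS · folklore]
-/

noncomputable section

open CategoryTheory AlgebraicGeometry
open Literature.AlgebraicGeometry.Resolution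
open Summit.ResolutionOfSingularities.ResolutionOfSingularities.Theses.WeightedInvariant

set_option linter.dupNamespace false -- mandated namespace of this single-conjunct summit

namespace Summit.ResolutionOfSingularities.ResolutionOfSingularities.Theorems

/-- **Old door ⇒ new door**: a weighted resolution datum restricts to a hypersurface terminating
centre datum (`HypersurfaceTerminatingCentreDatum.nonempty_of_nonempty_datum`). [folklore] -/
theorem hypersurfaceCentreConstruction_of_weightedConstruction (h : WeightedConstruction) :
    HypersurfaceCentreConstruction :=
  fun p hp => HypersurfaceTerminatingCentreDatum.nonempty_of_nonempty_datum (h p hp)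

/-- **Local engine + globalization ⇒ new door** — the composition carried by the skeleton line
`Cruxes/HypersurfaceCentreConstruction/Lines/local_engine.lean` (stubs = `LocalWeightedDrop`,
`GlobalizeLocalDrop` by name). [folklore] -/
theorem hypersurfaceCentreConstruction_of_localEngine (hL : LocalWeightedDrop)
    (hG : GlobalizeLocalDrop) : HypersurfaceCentreConstruction :=
  hypersurfaceCentreConstruction_of_weightedConstruction (hG hL)

/-- **New consumer ⇒ old derived support** `DatumToResolution` (restrict along old ⇒ new). [folklore] -/
theorem datumToResolution_of_hypersurfaceCentreToResolution (h : HypersurfaceCentreToResolution) :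
    DatumToResolution :=
  fun p hp hN k _ _ _ X f hs hl hq hr =>
    h p hp (HypersurfaceTerminatingCentreDatum.nonempty_of_nonempty_datum hN) k X f hs hl hq hr

/-- **Hypersurface resolution datum ⇒ new door**: a hypersurfaces-only weighted resolution datum in every characteristic
(`Theorems.HypersurfaceResolutionDatum p` — the conclusion of `stub_globalize` of line `transversal-dimension-ladder` under
`GlobalizeLocalDrop`, stmt-14763, and of line `datum-glued-split`'s `HypersurfaceConstruction`) already gives the door crux
`HypersurfaceCentreConstruction` (stmt-19897), through `HypersurfaceTerminatingCentreDatum.ofHypersurfaceDatum`; the further step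
`stub_extend` (hypersurface datum ⇒ full datum = `WeightedConstruction`) of that ladder is OFF the route's closing path. [folklore] -/
theorem hypersurfaceCentreConstruction_of_hypersurfaceDatum
    (h : ∀ p : ℕ, p.Prime → Nonempty (HypersurfaceResolutionDatum p)) : HypersurfaceCentreConstruction :=
  fun p hp => (h p hp).map HypersurfaceTerminatingCentreDatum.ofHypersurfaceDatum

end Summit.ResolutionOfSingularities.ResolutionOfSingularities.Theorems

end
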